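import Literature.NumberTheory.EllipticCurves.Sprung2017.HalfLogarithmMatrixInvolutionOffDiagProofs
import Summits.BirchSwinnertonDyer.BirchSwinnertonDyer.Theorems.SignedLowerHalvesSprungLowerDivisibilityAtThreeIotaStability
import HarnessLib

/-!
# Crux `SprungLowerDivisibilityAtThree` (K1, item stmt-BirchSwinnertonDyer-19875), line `chromatic-common-zeros`:
# `L♯` IS DETERMINED BY `L♭` — `3T·u·L♯ = κ′·L♭(T^ι) − m·L♭` — and the common zeros of the two colours off
# `(3)`, `(T)` are exactly the ι-PAIRED zeros of ONE colour (class-wide, input-free)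

Cell `bsd-ssimc` (host), width seat `cruxlead-stmt-BirchSwinnertonDyer-19875-w3` (gen 5) under the 19875 lead; `--supports`
19875 `--as helper`; theorems only; closes NO item (skeleton v8 unchanged). K1, BSD and leaf X8 are NOT proved by anything
here. x8 DOSSIER v2.35 T59 (S6) / item 254.

## What is proved

The integral transition matrix `M` of `ℒ = M·ℒ(T^ι)` (`ℒ = halfLogMatrix b`, `a₃ = 3b`, `ι : T ↦ (1+T)⁻¹ − 1`) has
`M₀₁ = C(3)·T·u` with `u ∈ Λˣ` when `3 ∤ b` (`exists_integral_halfLogMatrix_offDiag_eq_C_mul_X_mul_unit`: `M ≡ 1 mod T`,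
`3 ∣ M₀₁`, `[T¹]M₀₁ ≡ 6b mod 9`). Cancelling `ℒ` in the trace-coordinate functional equation (PROVED, p621498) exactly as
in `…IotaStability` / `…IotaParity` gives, for every X8 pair (`b = ±1`), newform and Sprung pair, in `Λ = ℤ₃⟦T⟧`:

* **`ClassX8.exists_pair_functionalEquation`** — THE PAIR FUNCTIONAL EQUATION BY NAME: units `κ′`, `u` and
  `m₀₀, g, m₁₁ ∈ Λ` with `m₀₀(0) = m₁₁(0) = 1` and
  `κ′·L♯(T^ι) = m₀₀·L♯ + C(3)·T·g·L♭`, `κ′·L♭(T^ι) = C(3)·T·u·L♯ + m₁₁·L♭`;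
* **`ClassX8.exists_C_mul_X_mul_unit_mul_sharp_eq`** — `C(3)·T·u·L♯ = κ′·L♭(T^ι) − m·L♭`: the PAIR is determined by
  `L♭` alone;
* **`ClassX8.sharp_mem_of_flat_mem_of_subst_flat_mem`** / **`ClassX8.mem_and_mem_iff_flat_iotaPair`** — for every
  PRIME ideal `𝔭 ⊂ Λ` with `3 ∉ 𝔭`, `T ∉ 𝔭`: `L♯, L♭ ∈ 𝔭 ⟺ L♭, L♭(T^ι) ∈ 𝔭` (⇒ is the ι-stability of `(L♯, L♭)`,
  p634976). So the COMMON-ZERO LOCUS of the line off `(3)`, `(T)` — the sporadic primes of stub K_spor and the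
  positive-level cyclotomic primes of stub S4b-cyc — is «the ι-PAIRED zeros of `L♭`», a ONE-COLOUR condition;
* `ClassX8.noCommonPrime_iff_flat_noIotaPair` — the per-pair data of the two-colour doors (R0)/(R3) and of the
  one-colour doors (R14)♭/(R15)♭ (`…IotaSelfCoprime`) are EQUIVALENT off `(3)`, `(T)`;
* `ClassX8.forall_normalised_mem_iff_flat_iotaPair` — the skeleton's binder «every Néron-normalised `G^{•′}` lies in
  `𝔭`» (`hcommon` of K_spor / S4b-cyc, `|ϖ|₃ = 1`) ⟺ `L♭ ∈ 𝔭 ∧ L♭(T^ι) ∈ 𝔭`; `X_not_mem_of_not_exists_omega_mem`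
  (`ω₀ = T`) supplies `T ∉ 𝔭` from K_spor's «no `ω_n ∈ 𝔭`».

Not claimed: nothing towards K_spor / S4b-cyc themselves; the ♯-row has `M₁₀ = 3T·(non-unit)` in general, so «`L♭`
from `L♯`» holds only off the zeros of that factor and is not stated.
-- TODO(general form): any odd `p` with `p ∥ a_p` (the `T¹`-congruence reads `[T¹]M₀₁ ≡ (p−1)·a_p mod p²`).

References: [Sprung2017] Thm. 1.1, §3.4 Prop. 3.14, Thm. 4.13, Cor. 4.4, Cor. 4.6, Cor. 4.14; [MazurTateTeitelbaum1986Invent]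
§I.17; [GreenbergLNM1716] §1 and §5 (the root pairing `a ↦ (1+a)⁻¹ − 1`); [Sprung2012] Def. 6.1, Main Conj. 7.21 (context).
-/

set_option linter.dupNamespace false
set_option autoImplicit false

noncomputable section

open scoped Classical MatrixGroups ModularForm

open CongruenceSubgroup WeierstrassCurve Polynomial
  Literature.NumberTheory.EllipticCurves Literature.NumberTheory.EllipticCurves.ModularForms
  Literature.NumberTheory.EllipticCurves.Sprung2017 Literature.NumberTheory.EllipticCurves.Rank1Residual
  Literature.Barriers.BirchSwinnertonDyer Summit.BirchSwinnertonDyer.Rank1Residual.Supersingular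

namespace Summit.BirchSwinnertonDyer.BirchSwinnertonDyer.Theorems.ChromaticIota

/-! ## §1 Algebra in `Λ = ℤ_p⟦T⟧` -/

section Algebra

variable {p : ℕ} [hp : Fact p.Prime]

/-- In a prime ideal `𝔭 ⊂ Λ` containing neither `p` nor `T`: `C(p)·T·u·F ∈ 𝔭` with `u` a unit forces `F ∈ 𝔭`.
[folklore] -/
theorem mem_of_C_mul_X_mul_unit_mul_mem {𝔭 : Ideal (IwasawaAlgebra p)} (h𝔭 : 𝔭.IsPrime)
    (hp𝔭 : (p : IwasawaAlgebra p) ∉ 𝔭) (hT : (PowerSeries.X : IwasawaAlgebra p) ∉ 𝔭) {u F : IwasawaAlgebra p}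
    (hu : IsUnit u) (h : PowerSeries.C (p : ℤ_[p]) * PowerSeries.X * u * F ∈ 𝔭) : F ∈ 𝔭 := by
  rcases h𝔭.mem_or_mem h with h1 | hF
  · rcases h𝔭.mem_or_mem h1 with h2 | hu𝔭
    · rcases h𝔭.mem_or_mem h2 with hC | hX
      · rw [map_natCast] at hC
        exact absurd hC hp𝔭
      · exact absurd hX hT
    · exact absurd (Ideal.eq_top_of_isUnit_mem _ hu𝔭 hu) h𝔭.ne_top
  · exact hF

/-- `ω₀ = T`: an ideal containing no `ω_n = (1+T)^{pⁿ} − 1` does not contain `T`. [folklore] -/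
theorem X_not_mem_of_not_exists_omega_mem {𝔭 : Ideal (IwasawaAlgebra p)}
    (hω : ¬ ∃ n : ℕ, ((cyclotomicOmega p n).map (Int.castRingHom ℤ_[p]) : PowerSeries ℤ_[p]) ∈ 𝔭) :
    (PowerSeries.X : IwasawaAlgebra p) ∉ 𝔭 := by
  intro hX
  refine hω ⟨0, ?_⟩
  rw [coe_map_cyclotomicOmega, pow_zero, pow_one, add_sub_cancel_left]
  exact hX

end Algebra

/-! ## §2 X8: the pair functional equation with `M₀₁ = 3T·(unit)`, and `L♯` from `L♭` -/

section X8

/-- `ι ∘ ι = id` on `ℚ_3⟦T⟧` (private plumbing). [folklore] -/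
private theorem subst_subst_rat₃ (g : PowerSeries ℚ_[3]) :
    PowerSeries.subst (invOnePlusSubOne : PowerSeries ℚ_[3])
      (PowerSeries.subst (invOnePlusSubOne : PowerSeries ℚ_[3]) g) = g := by
  have hι := hasSubst_invOnePlusSubOne (R := ℚ_[3])
  rw [PowerSeries.subst_comp_subst_apply hι hι, invOnePlusSubOne_subst_self, PowerSeries.X_subst]

/-- `det ℒ(0) = 1/9 ≠ 0` (private plumbing). [cite: Sprung2017, §3.1 (ℒ(0) = C⁻²)] -/
private theorem det_halfLogMatrix_ne_zero₃ (b : ℤ) :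
    halfLogMatrix b 0 0 * halfLogMatrix b 1 1 - halfLogMatrix b 0 1 * halfLogMatrix b 1 0 ≠ 0 := by
  intro h
  have h0 := congrArg PowerSeries.constantCoeff h
  rw [map_sub, map_mul, map_mul, constantCoeff_halfLogMatrix, constantCoeff_halfLogMatrix,
    constantCoeff_halfLogMatrix, constantCoeff_halfLogMatrix, map_zero] at h0
  have hdetQ : (sprungCinv 3 (3 * b) ^ 2).det = 1 / 9 := by
    rw [Matrix.det_pow, Matrix.det_fin_two]
    simp [sprungCinv]
    norm_num
  have hcast : (((sprungCinv 3 (3 * b) ^ 2).det : ℚ) : ℚ_[3]) = 0 := by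
    rw [Matrix.det_fin_two]
    push_cast
    linear_combination h0
  rw [hdetQ] at hcast
  norm_num at hcast

/-- Néron normalisation by a `p`-adic unit, read in `ℚ_p⟦T⟧` (private plumbing). [folklore] -/
private theorem iwasawaToPowerSeries_C_mul {p : ℕ} [Fact p.Prime] (w : ℤ_[p]) (L : IwasawaAlgebra p) :
    iwasawaToPowerSeries p (PowerSeries.C w * L) = PowerSeries.C (w : ℚ_[p]) * iwasawaToPowerSeries p L := by
  rw [map_mul]
  congr 1
  rw [iwasawaToPowerSeries, PowerSeries.map_C]
  rfl

/-- A power series with all coefficients divisible by `3` and zero constant term is `C(3)·T·g` (private plumbing).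
[folklore] -/
private theorem exists_eq_C_mul_X_mul_of_forall_dvd {M : IwasawaAlgebra 3}
    (h : ∀ j, (3 : ℤ_[3]) ∣ PowerSeries.coeff j M) (h0 : PowerSeries.constantCoeff M = 0) :
    ∃ g : IwasawaAlgebra 3, M = PowerSeries.C ((3 : ℕ) : ℤ_[3]) * PowerSeries.X * g := by
  choose g hg using h
  have hg0 : g 0 = 0 := by
    have h := hg 0
    rw [PowerSeries.coeff_zero_eq_constantCoeff_apply, h0] at h
    rcases mul_eq_zero.mp h.symm with h3 | h00
    · exact absurd h3 (by norm_num)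
    · exact h00
  refine ⟨PowerSeries.mk fun j => g (j + 1), ?_⟩
  ext j
  rw [mul_assoc, PowerSeries.coeff_C_mul, hg j]
  push_cast
  rcases j with _ | j
  · rw [PowerSeries.coeff_zero_X_mul, hg0, mul_zero]
  · rw [PowerSeries.coeff_succ_X_mul, PowerSeries.coeff_mk]

/-- **THE PAIR FUNCTIONAL EQUATION OF AN X8 SPRUNG PAIR, BY NAME.** For every X8 pair `(W, 3)`, newform `f`, Sprung pair
`(L♯, L♭)`: there are units `κ′, u ∈ Λˣ` and `m₀₀, g, m₁₁ ∈ Λ` with `m₀₀(0) = m₁₁(0) = 1` such that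
`κ′·L♯(T^ι) = m₀₀·L♯ + C(3)·T·g·L♭` and `κ′·L♭(T^ι) = C(3)·T·u·L♯ + m₁₁·L♭` (`κ′ = (σ(1+T)^c)(T^ι)`, `σ` the Fricke
sign, `c` the Teichmüller exponent of the level; `(m₀₀, 3Tu; 3Tg, m₁₁) = M` the integral transition matrix of `ℒ = M·ℒ(T^ι)`).
Class-wide, input-free. [cite: Sprung2017, Thm. 1.1, Thm. 4.13, Cor. 4.14, Prop. 3.14, Cor. 4.4 and Cor. 4.6]
[cite: MazurTateTeitelbaum1986Invent, §I.17] [cite: GreenbergLNM1716, §1] -/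
theorem ClassX8.exists_pair_functionalEquation (W : WeierstrassCurve ℚ) [W.IsElliptic] [W.IsGloballyMinimal]
    (p : ℕ) [Fact p.Prime] (hX : ClassX8 W p) {N : ℕ} [hN : NeZero N] (f : CuspForm (Gamma0 N) 2)
    (hf : IsNewformOf W f) (Lsharp Lflat : IwasawaAlgebra p)
    (hSP : IsSprungPair f p (W.frobeniusTrace p) Lsharp Lflat) :
    ∃ κ' u m₀₀ g m₁₁ : IwasawaAlgebra p, IsUnit κ' ∧ IsUnit u ∧
      PowerSeries.constantCoeff m₀₀ = 1 ∧ PowerSeries.constantCoeff m₁₁ = 1 ∧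
      κ' * PowerSeries.subst (invOnePlusSubOne : IwasawaAlgebra p) Lsharp =
        m₀₀ * Lsharp + PowerSeries.C (p : ℤ_[p]) * PowerSeries.X * g * Lflat ∧
      κ' * PowerSeries.subst (invOnePlusSubOne : IwasawaAlgebra p) Lflat =
        PowerSeries.C (p : ℤ_[p]) * PowerSeries.X * u * Lsharp + m₁₁ * Lflat := by
  obtain ⟨hp3, ⟨hgood, -⟩, -⟩ := id hX
  subst hp3
  haveI : NeZero N := hN
  -- `a_3 = 3b`, `b = ±1`, so `3 ∤ b`
  obtain ⟨b, hb, hab⟩ : ∃ b : ℤ, (b = 1 ∨ b = -1) ∧ W.frobeniusTrace 3 = 3 * b := by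
    rcases ClassX8.frobeniusTrace_eq_three_or W 3 hX with h | h
    · exact ⟨1, Or.inl rfl, by rw [h]; norm_num⟩
    · exact ⟨-1, Or.inr rfl, by rw [h]; norm_num⟩
  have hb3 : ¬ (3 : ℤ) ∣ b := by rcases hb with rfl | rfl <;> decide
  rw [hab] at hSP
  -- the Fricke sign of the newform
  have hsm := IsNewform0.frickeInvolution_eq_smul_holds (N := N) (k := (2 : ℤ)) hf.1
  have hFr : IsFrickeEigen N f (frickeEigenvalue f) := isFrickeEigen_of_frickeInvolution_eq_smul N hsm
  obtain ⟨σ, hσ, hW⟩ : ∃ σ : ℤ, σ ^ 2 = 1 ∧ IsFrickeEigen N f (-(σ : ℂ)) := by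
    rcases IsNewform0.frickeEigenvalue_eq_one_or_eq_neg_one_holds (N := N) (k := (2 : ℤ)) hf.1 with h1 | h1
    · refine ⟨-1, by norm_num, ?_⟩
      have : (-((-1 : ℤ) : ℂ)) = frickeEigenvalue f := by rw [h1]; push_cast; ring
      rw [this]; exact hFr
    · refine ⟨1, by norm_num, ?_⟩
      have : (-((1 : ℤ) : ℂ)) = frickeEigenvalue f := by rw [h1]; push_cast; ring
      rw [this]; exact hFr
  -- the Teichmüller exponent of the level (`3 ∤ N`)
  have hpN : ¬ 3 ∣ N := not_dvd_level_of_isNewformOf hf hgood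
  obtain ⟨ηN, c, hc⟩ := exists_teichmuller_exponent_natCast (p := 3) hpN
  -- the functional equation of the trace coordinates (PROVED fact) and the refined integral transition matrix
  have hFE := thm413_traceCoordinate_functionalEquation_three_holds W N f b hb hf hgood hab σ hσ hW ηN c hc
    invOnePlusSubOne one_add_X_mul_invOnePlusSubOne_add_one Lsharp Lflat hSP
  obtain ⟨M, ⟨u, hu, hM01⟩, hM10, hM00, hM11, hM10z, hM⟩ :=
    exists_integral_halfLogMatrix_offDiag_eq_C_mul_X_mul_unit b hb3
  -- cancelling `ℒ` in `ℚ_3⟦T⟧`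
  have hι := hasSubst_invOnePlusSubOne (R := ℚ_[3])
  set τ : PowerSeries ℚ_[3] →+* PowerSeries ℚ_[3] := (PowerSeries.substAlgHom hι).toRingHom with hτ
  have hτapp : ∀ x : PowerSeries ℚ_[3], τ x = PowerSeries.subst (invOnePlusSubOne : PowerSeries ℚ_[3]) x :=
    fun x => by rw [hτ, AlgHom.toRingHom_eq_coe, RingHom.coe_coe, PowerSeries.coe_substAlgHom]
  have hττ : ∀ x, τ (τ x) = x := fun x => by rw [hτapp, hτapp, subst_subst_rat₃]
  set κ : PowerSeries ℚ_[3] :=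
    (σ : PowerSeries ℚ_[3]) * (PowerSeries.binomialSeries ℤ_[3] c).map (algebraMap ℤ_[3] ℚ_[3]) with hκ
  set L : Fin 2 → PowerSeries ℚ_[3] := ![iwasawaToPowerSeries 3 Lsharp, iwasawaToPowerSeries 3 Lflat] with hL
  have hL0 : L 0 = iwasawaToPowerSeries 3 Lsharp := rfl
  have hL1 : L 1 = iwasawaToPowerSeries 3 Lflat := rfl
  have hFE' : ∀ k : Fin 2, τ (L 0 * halfLogMatrix b 0 k + L 1 * halfLogMatrix b 1 k) =
      κ * (L 0 * halfLogMatrix b 0 k + L 1 * halfLogMatrix b 1 k) := by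
    intro k
    rw [hτapp, hL0, hL1]
    exact hFE k
  have hM' : ∀ i k : Fin 2, halfLogMatrix b i k =
      (M.map (iwasawaToPowerSeries 3)) i 0 * τ (halfLogMatrix b 0 k) +
        (M.map (iwasawaToPowerSeries 3)) i 1 * τ (halfLogMatrix b 1 k) := by
    intro i k
    rw [Matrix.map_apply, Matrix.map_apply, hτapp, hτapp]
    exact hM i k
  have key := mul_map_eq_of_traceFE τ hττ L (halfLogMatrix b) (M.map (iwasawaToPowerSeries 3)) κ hFE' hM'
    (det_halfLogMatrix_ne_zero₃ b)
  -- pull back to `Λ`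
  set κΛ : IwasawaAlgebra 3 := (σ : IwasawaAlgebra 3) * PowerSeries.binomialSeries ℤ_[3] c with hκΛ
  have hκι : κ = iwasawaToPowerSeries 3 κΛ := by rw [hκ, hκΛ, map_mul, map_intCast]
  have hunit : IsUnit (PowerSeries.subst (invOnePlusSubOne : IwasawaAlgebra 3) κΛ) := by
    have hu' : IsUnit κΛ := by
      rw [hκΛ]
      refine IsUnit.mul ?_ ?_
      · have : (σ : IwasawaAlgebra 3) * (σ : IwasawaAlgebra 3) = 1 := by
          rw [← pow_two, ← Int.cast_pow, hσ, Int.cast_one]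
        exact isUnit_iff_exists_inv.mpr ⟨_, this⟩
      · rw [PowerSeries.isUnit_iff_constantCoeff, PowerSeries.binomialSeries_constantCoeff]
        exact isUnit_one
    have hιΛ := hasSubst_invOnePlusSubOne (R := ℤ_[3])
    rw [← PowerSeries.coe_substAlgHom hιΛ]
    exact hu'.map _
  have hpull : ∀ (Ll : IwasawaAlgebra 3) (m0 m1 : IwasawaAlgebra 3),
      τ κ * τ (iwasawaToPowerSeries 3 Ll) = iwasawaToPowerSeries 3 Lsharp * iwasawaToPowerSeries 3 m0 +
        iwasawaToPowerSeries 3 Lflat * iwasawaToPowerSeries 3 m1 →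
      PowerSeries.subst (invOnePlusSubOne : IwasawaAlgebra 3) κΛ *
          PowerSeries.subst (invOnePlusSubOne : IwasawaAlgebra 3) Ll = Lsharp * m0 + Lflat * m1 := by
    intro Ll m0 m1 h
    apply iwasawaToPowerSeries_injective 3
    rw [map_mul, map_add, map_mul, map_mul, iwasawaToPowerSeries_subst_invOnePlusSubOne,
      iwasawaToPowerSeries_subst_invOnePlusSubOne, ← hκι, ← hτapp, ← hτapp]
    exact h
  have hs : PowerSeries.subst (invOnePlusSubOne : IwasawaAlgebra 3) κΛ *
      PowerSeries.subst (invOnePlusSubOne : IwasawaAlgebra 3) Lsharp = Lsharp * M 0 0 + Lflat * M 1 0 := by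
    apply hpull
    have h := key 0
    rw [hL0, hL1, Matrix.map_apply, Matrix.map_apply] at h
    simpa using h
  have hfl : PowerSeries.subst (invOnePlusSubOne : IwasawaAlgebra 3) κΛ *
      PowerSeries.subst (invOnePlusSubOne : IwasawaAlgebra 3) Lflat = Lsharp * M 0 1 + Lflat * M 1 1 := by
    apply hpull
    have h := key 1
    rw [hL0, hL1, Matrix.map_apply, Matrix.map_apply] at h
    simpa using h
  obtain ⟨g, hg⟩ := exists_eq_C_mul_X_mul_of_forall_dvd hM10 hM10z
  refine ⟨PowerSeries.subst (invOnePlusSubOne : IwasawaAlgebra 3) κΛ, u, M 0 0, g, M 1 1, hunit, hu, hM00, hM11,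
    ?_, ?_⟩
  · rw [hs, hg]
    push_cast
    ring
  · rw [hfl, hM01]
    push_cast
    ring

/-- **`L♯` FROM `L♭` (X8, class-wide, input-free).** For every X8 pair, newform and Sprung pair there are units `κ′, u ∈ Λˣ`
and `m ∈ Λ` with `m(0) = 1` such that `C(3)·T·u·L♯ = κ′·L♭(T^ι) − m·L♭`. [cite: Sprung2017, Thm. 4.13, Cor. 4.14, Prop. 3.14
and Cor. 4.6] [cite: MazurTateTeitelbaum1986Invent, §I.17] -/
theorem ClassX8.exists_C_mul_X_mul_unit_mul_sharp_eq (W : WeierstrassCurve ℚ) [W.IsElliptic] [W.IsGloballyMinimal]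
    (p : ℕ) [Fact p.Prime] (hX : ClassX8 W p) {N : ℕ} [hN : NeZero N] (f : CuspForm (Gamma0 N) 2)
    (hf : IsNewformOf W f) (Lsharp Lflat : IwasawaAlgebra p)
    (hSP : IsSprungPair f p (W.frobeniusTrace p) Lsharp Lflat) :
    ∃ κ' u m : IwasawaAlgebra p, IsUnit κ' ∧ IsUnit u ∧ PowerSeries.constantCoeff m = 1 ∧
      PowerSeries.C (p : ℤ_[p]) * PowerSeries.X * u * Lsharp =
        κ' * PowerSeries.subst (invOnePlusSubOne : IwasawaAlgebra p) Lflat - m * Lflat := by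
  obtain ⟨κ', u, -, -, m₁₁, hκ', hu, -, hm₁₁, -, hfl⟩ :=
    ClassX8.exists_pair_functionalEquation W p hX f hf Lsharp Lflat hSP
  exact ⟨κ', u, m₁₁, hκ', hu, hm₁₁, by rw [hfl]; ring⟩

/-- **ι-PAIRED ZEROS OF `L♭` ARE COMMON ZEROS.** For every X8 pair, newform, Sprung pair and every PRIME ideal `𝔭 ⊂ Λ` with
`3 ∉ 𝔭`, `T ∉ 𝔭`: `L♭ ∈ 𝔭` and `L♭(T^ι) ∈ 𝔭` imply `L♯ ∈ 𝔭`. [cite: Sprung2017, Thm. 4.13, Cor. 4.14, Prop. 3.14 and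
Cor. 4.6] [cite: GreenbergLNM1716, §1 and §5] -/
theorem ClassX8.sharp_mem_of_flat_mem_of_subst_flat_mem (W : WeierstrassCurve ℚ) [W.IsElliptic]
    [W.IsGloballyMinimal] (p : ℕ) [Fact p.Prime] (hX : ClassX8 W p) {N : ℕ} [hN : NeZero N]
    (f : CuspForm (Gamma0 N) 2) (hf : IsNewformOf W f) (Lsharp Lflat : IwasawaAlgebra p)
    (hSP : IsSprungPair f p (W.frobeniusTrace p) Lsharp Lflat) (𝔭 : Ideal (IwasawaAlgebra p)) (h𝔭 : 𝔭.IsPrime)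
    (hp𝔭 : (p : IwasawaAlgebra p) ∉ 𝔭) (hT : (PowerSeries.X : IwasawaAlgebra p) ∉ 𝔭) (hfl : Lflat ∈ 𝔭)
    (hflι : PowerSeries.subst (invOnePlusSubOne : IwasawaAlgebra p) Lflat ∈ 𝔭) : Lsharp ∈ 𝔭 := by
  obtain ⟨κ', u, m, -, hu, -, heq⟩ := ClassX8.exists_C_mul_X_mul_unit_mul_sharp_eq W p hX f hf Lsharp Lflat hSP
  refine mem_of_C_mul_X_mul_unit_mul_mem h𝔭 hp𝔭 hT hu ?_
  rw [heq]
  exact 𝔭.sub_mem (𝔭.mul_mem_left _ hflι) (𝔭.mul_mem_left _ hfl)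

/-- **COMMON ZEROS OFF `(3)`, `(T)` = ι-PAIRED ZEROS OF ONE COLOUR (X8, class-wide, input-free).** For every X8 pair,
newform, Sprung pair and every prime ideal `𝔭 ⊂ Λ` with `3 ∉ 𝔭`, `T ∉ 𝔭`:
`(L♯ ∈ 𝔭 ∧ L♭ ∈ 𝔭) ⟺ (L♭ ∈ 𝔭 ∧ L♭(T^ι) ∈ 𝔭)`. (⇒: ι-stability of `(L♯, L♭)`; ⇐: `3T·u·L♯ = κ′L♭(T^ι) − mL♭`.)
This is the one-colour reading of the loci of stubs K_spor (sporadic primes) and S4b-cyc (positive-level cyclotomic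
primes) of the line. [cite: Sprung2017, Thm. 4.13, Cor. 4.14, Prop. 3.14 and Cor. 4.6] [cite: GreenbergLNM1716, §1 and §5]
[cite: Sprung2012, Main Conj. 7.21 (context)] -/
theorem ClassX8.mem_and_mem_iff_flat_iotaPair (W : WeierstrassCurve ℚ) [W.IsElliptic] [W.IsGloballyMinimal]
    (p : ℕ) [Fact p.Prime] (hX : ClassX8 W p) {N : ℕ} [hN : NeZero N] (f : CuspForm (Gamma0 N) 2)
    (hf : IsNewformOf W f) (Lsharp Lflat : IwasawaAlgebra p)
    (hSP : IsSprungPair f p (W.frobeniusTrace p) Lsharp Lflat) (𝔭 : Ideal (IwasawaAlgebra p)) (h𝔭 : 𝔭.IsPrime)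
    (hp𝔭 : (p : IwasawaAlgebra p) ∉ 𝔭) (hT : (PowerSeries.X : IwasawaAlgebra p) ∉ 𝔭) :
    (Lsharp ∈ 𝔭 ∧ Lflat ∈ 𝔭) ↔
      (Lflat ∈ 𝔭 ∧ PowerSeries.subst (invOnePlusSubOne : IwasawaAlgebra p) Lflat ∈ 𝔭) := by
  constructor
  · rintro ⟨hs, hfl⟩
    exact ⟨hfl, (ClassX8.subst_invOnePlusSubOne_mem_of_mem W p hX N hN f Lsharp Lflat hf hSP 𝔭 hs hfl).2⟩
  · rintro ⟨hfl, hflι⟩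
    exact ⟨ClassX8.sharp_mem_of_flat_mem_of_subst_flat_mem W p hX f hf Lsharp Lflat hSP 𝔭 h𝔭 hp𝔭 hT hfl hflι,
      hfl⟩

/-- **The two-colour and the one-colour per-pair data agree off `(3)`, `(T)`.** For an X8 Sprung pair: «no height-one
prime `𝔮 ∌ 3, T` contains both `L♯` and `L♭`» ⟺ «no height-one prime `𝔮 ∌ 3, T` contains both `L♭` and `L♭(T^ι)`»
(the data of the doors (R0)/(R3) resp. (R14)♭/(R15)♭ away from `(3)`, `(T)`). [cite: Sprung2017, Thm. 4.13 and Cor. 4.14]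
[cite: GreenbergLNM1716, §1 and §5] -/
theorem ClassX8.noCommonPrime_iff_flat_noIotaPair (W : WeierstrassCurve ℚ) [W.IsElliptic] [W.IsGloballyMinimal]
    (p : ℕ) [Fact p.Prime] (hX : ClassX8 W p) {N : ℕ} [hN : NeZero N] (f : CuspForm (Gamma0 N) 2)
    (hf : IsNewformOf W f) (Lsharp Lflat : IwasawaAlgebra p)
    (hSP : IsSprungPair f p (W.frobeniusTrace p) Lsharp Lflat) :
    (∀ 𝔮 : PrimeSpectrum (IwasawaAlgebra p), 𝔮.asIdeal.height = 1 →
        (p : IwasawaAlgebra p) ∉ 𝔮.asIdeal → (PowerSeries.X : IwasawaAlgebra p) ∉ 𝔮.asIdeal →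
        ¬ (Lsharp ∈ 𝔮.asIdeal ∧ Lflat ∈ 𝔮.asIdeal)) ↔
      (∀ 𝔮 : PrimeSpectrum (IwasawaAlgebra p), 𝔮.asIdeal.height = 1 →
        (p : IwasawaAlgebra p) ∉ 𝔮.asIdeal → (PowerSeries.X : IwasawaAlgebra p) ∉ 𝔮.asIdeal →
        ¬ (Lflat ∈ 𝔮.asIdeal ∧
          PowerSeries.subst (invOnePlusSubOne : IwasawaAlgebra p) Lflat ∈ 𝔮.asIdeal)) := by
  refine forall_congr' fun 𝔮 => forall_congr' fun _ => forall_congr' fun hp𝔮 => forall_congr' fun hT => ?_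
  rw [ClassX8.mem_and_mem_iff_flat_iotaPair W p hX f hf Lsharp Lflat hSP 𝔮.asIdeal 𝔮.isPrime hp𝔮 hT]

/-- **The skeleton's binder in one-colour currency.** In the binder context of stubs K_spor / S4b-cyc (Néron normalisation
by `ϖ` with `|ϖ|_p = 1` — on X8 supplied by the period unit `h3` via `X8_norm_periodRatio_eq_one`), for a prime `𝔭 ∌ p, T`:
«every normalised `G^{•′}` (`G^{•′} = C(ϖ)·L^{•′}` in `ℚ_p⟦T⟧`) of every colour lies in `𝔭`» ⟺ `L♭ ∈ 𝔭 ∧ L♭(T^ι) ∈ 𝔭`.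
[cite: Sprung2017, Thm. 4.13 and Cor. 4.14] [cite: Sprung2012, Def. 6.1 and Main Conj. 7.21 (context)] -/
theorem ClassX8.forall_normalised_mem_iff_flat_iotaPair (W : WeierstrassCurve ℚ) [W.IsElliptic]
    [W.IsGloballyMinimal] (p : ℕ) [Fact p.Prime] (hX : ClassX8 W p) {N : ℕ} [hN : NeZero N]
    (f : CuspForm (Gamma0 N) 2) (hf : IsNewformOf W f) {ϖ : ℚ} (hϖ1 : ‖(ϖ : ℚ_[p])‖ = 1)
    (Lsharp Lflat : IwasawaAlgebra p) (hSP : IsSprungPair f p (W.frobeniusTrace p) Lsharp Lflat)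
    (𝔭 : Ideal (IwasawaAlgebra p)) (h𝔭 : 𝔭.IsPrime) (hp𝔭 : (p : IwasawaAlgebra p) ∉ 𝔭)
    (hT : (PowerSeries.X : IwasawaAlgebra p) ∉ 𝔭) :
    (∀ (col' : Chroma) (G' : IwasawaAlgebra p),
        iwasawaToPowerSeries p G' = PowerSeries.C (ϖ : ℚ_[p]) * iwasawaToPowerSeries p (chromaticL col' Lsharp Lflat) →
        G' ∈ 𝔭) ↔
      (Lflat ∈ 𝔭 ∧ PowerSeries.subst (invOnePlusSubOne : IwasawaAlgebra p) Lflat ∈ 𝔭) := by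
  set w : ℤ_[p]ˣ := PadicInt.mkUnits hϖ1 with hw
  have hnorm : ∀ c' : Chroma, iwasawaToPowerSeries p (PowerSeries.C (w : ℤ_[p]) * chromaticL c' Lsharp Lflat) =
      PowerSeries.C (ϖ : ℚ_[p]) * iwasawaToPowerSeries p (chromaticL c' Lsharp Lflat) := by
    intro c'
    rw [iwasawaToPowerSeries_C_mul, hw, PadicInt.mkUnits_eq]
  have hCu : IsUnit (PowerSeries.C (w : ℤ_[p]) : IwasawaAlgebra p) := (Units.isUnit w).map PowerSeries.C
  rw [← ClassX8.mem_and_mem_iff_flat_iotaPair W p hX f hf Lsharp Lflat hSP 𝔭 h𝔭 hp𝔭 hT]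
  constructor
  · intro hall
    have hs := hall Chroma.sharp _ (hnorm Chroma.sharp)
    have hf' := hall Chroma.flat _ (hnorm Chroma.flat)
    rw [chromaticL_sharp, Ideal.unit_mul_mem_iff_mem 𝔭 hCu] at hs
    rw [chromaticL_flat, Ideal.unit_mul_mem_iff_mem 𝔭 hCu] at hf'
    exact ⟨hs, hf'⟩
  · rintro ⟨hs, hfl⟩ col' G' hG'
    have hG'eq : G' = PowerSeries.C (w : ℤ_[p]) * chromaticL col' Lsharp Lflat :=
      iwasawaToPowerSeries_injective p (by rw [hG', hnorm])
    rw [hG'eq, Ideal.unit_mul_mem_iff_mem 𝔭 hCu]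
    cases col' with
    | sharp => simpa using hs
    | flat => simpa using hfl

end X8

end Summit.BirchSwinnertonDyer.BirchSwinnertonDyer.Theorems.ChromaticIota

end
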